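import Summits.MatrixMultiplication.OmegaCensus.SmallFormats.InvertiblePointDeltaBlocks
import Summits.MatrixMultiplication.OmegaCensus.SmallFormats.KroneckerBlocks
import HarnessLib

/-!
# ω-census family (a): the δ-TABLE — `δ(L₁ᵀ) = 2`, `δ(L₂ᵀ) = 1`, `δ = 0` for every other Kronecker block (any field)

Cell `pub-omega` (unit `pub-omega-tensor`, gen 34), topic `Summits/MatrixMultiplication/OmegaCensus` (sub-folder
`SmallFormats`). Framing (verbatim): lottery ticket; floor = certified bounds/negative ranges. HONEST FRAMING: elementary
linear algebra over an arbitrary field; the per-block VALUES of tensor g24's δ-engine (`DELTA-ENGINE.md` §5, computed there by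
exact `𝔽₃` rank arithmetic check by check) as theorems valid for the universal block-footprint span (`deltaSpan`, file
`InvertiblePointDeltaBlocks`): for the standard space `S(blk)` of a Weierstraß–Kronecker block `blk` (conventions of
`KroneckerBlocks`, tensor g33) and ANY `𝒯 ≤ deltaSpan S(blk)`,
`dim (range(B ↦ (X ↦ X·B)) ⊓ 𝒯) ≤ δ(blk)` with `δ(L₁ᵀ) = 2`, `δ(L₂ᵀ) = 1`, `δ(L_ηᵀ) = 0 (η ≥ 3)`,
`δ(L_ε) = δ(N_u) = δ(C_c) = 0` (`finrank_inf_le_delta`). Each case is the master lemma `symm_of_mem_deltaSpan` applied to a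
column pair on which the block space is symmetric (consecutive columns of `L_ηᵀ`, `(e_c, B-column c)` of `N_u`,
`(A-column c, e_c)` of `C_c`, `(e_c, e_{c−1})` of `L_ε`). Also: `L_topRight_eq_zero` — every block footprint in `L_ε`
position has zero top-right entry (used in `InvertiblePointDeltaLaw` to show that `L_ε` blocks do not occur at a
saturated point). Nothing here is a rank bound by itself and nothing is a bound on `ω`.
-/

namespace Summit.MatrixMultiplication.OmegaCensus.SmallFormats

open Module Matrix Literature.Computability.AlgebraicComplexity
open DeltaBlocks

namespace Kronecker.KBlock

variable {k : Type*} [Field k]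

/-- Generator `r` of the standard block space of a block: the `2 × cols` matrix with rows `(A r ·)` and `(B r ·)`
(the images `a(e_r)`, `b(e_r)` of the `r`-th row vector in the column basis of the block). -/
def gen (blk : KBlock k) (r : ℕ) : Matrix (Fin 2) (Fin blk.cols) k :=
  fun i j => if i = 0 then blk.A r j else blk.B r j

/-- The standard block space `S(blk) ⊆ k^{2 × cols}`: the span of the generators `gen r`, `r < rows`. -/
def space (blk : KBlock k) : Submodule k (Matrix (Fin 2) (Fin blk.cols) k) :=
  Submodule.span k (Set.range fun r : Fin blk.rows => blk.gen r)

/-- The δ-TABLE: `δ(L₁ᵀ) = 2`, `δ(L₂ᵀ) = 1`, every other block `0`. -/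
def delta : KBlock k → ℕ
  | LT 1 => 2
  | LT 2 => 1
  | _ => 0

/-- Top row of a generator = the `A`-part row. -/
@[simp] theorem gen_zero_apply (blk : KBlock k) (r : ℕ) (j : Fin blk.cols) : blk.gen r 0 j = blk.A r j := rfl
/-- Bottom row of a generator = the `B`-part row. -/
@[simp] theorem gen_one_apply (blk : KBlock k) (r : ℕ) (j : Fin blk.cols) : blk.gen r 1 j = blk.B r j := by
  simp [gen]

/-! ### `L_ηᵀ` blocks: consecutive column pairs -/

/-- For an `L_ηᵀ` block and `c + 1 < η`, the column pair `(c, c+1)` is Hankel on the generators: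
`gen_r(0, c+1) = gen_r(1, c)`. -/
theorem LT_pair_symm (e : ℕ) (c : ℕ) (hc : c + 1 < e) :
    ∀ W ∈ (Set.range fun r : Fin (LT e : KBlock k).rows => (LT e : KBlock k).gen r),
      W 0 ⬝ᵥ (Pi.single (⟨c + 1, hc⟩ : Fin e) (1 : k)) =
        W 1 ⬝ᵥ (Pi.single (⟨c, by omega⟩ : Fin e) (1 : k)) := by
  rintro W ⟨r, rfl⟩
  dsimp only
  rw [dotProduct_single, dotProduct_single, mul_one, mul_one, gen_zero_apply, gen_one_apply]
  simp only [A, B]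

/-- **`δ(L_ηᵀ) = 0` for `η ≥ 3`:** if `X ↦ X·B` lies in the block-footprint span of an `L_ηᵀ` block space, `η ≥ 3`, then
`B = 0`. -/
theorem eq_zero_of_mem_deltaSpan_LT (e : ℕ) (he : 3 ≤ e) {B : Matrix (Fin 2) (Fin e) k}
    (hB : (mulBilin k 2 2 e).flip B ∈ deltaSpan (LT e : KBlock k).space) : B = 0 := by
  have H : ∀ c (hc : c + 1 < e), B 0 ⟨c, by omega⟩ = 0 ∧
      B 0 ⟨c + 1, hc⟩ + B 1 ⟨c, by omega⟩ = 0 ∧ B 1 ⟨c + 1, hc⟩ = 0 := by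
    intro c hc
    have h := dot_eq_zero_of_mem_deltaSpan (LT_pair_symm (k := k) e c hc) hB
    simp only [dotProduct_single, mul_one] at h
    exact h
  ext i j
  have hj := j.2
  rw [Matrix.zero_apply]
  fin_cases i
  · -- top row
    by_cases hj1 : (j : ℕ) + 1 < e
    · have := (H j hj1).1; simpa using this
    · -- `j = e - 1`: use the pairs `(e-2, e-1)` and `(e-3, e-2)`
      have h1 := (H (e - 2) (by omega)).2.1
      have h2 := (H (e - 3) (by omega)).2.2
      have hje : j = ⟨e - 2 + 1, by omega⟩ := Fin.ext (by simp; omega)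
      have hee : (⟨e - 3 + 1, by omega⟩ : Fin e) = ⟨e - 2, by omega⟩ := Fin.ext (by simp; omega)
      rw [hee] at h2
      rw [hje]; simpa [h2] using h1
  · -- bottom row
    by_cases hj0 : (j : ℕ) = 0
    · have h1 := (H 0 (by omega)).2.1
      have h2 := (H 1 (by omega)).1
      have hje : j = ⟨0, by omega⟩ := Fin.ext hj0
      have hee : (⟨0 + 1, by omega⟩ : Fin e) = ⟨1, by omega⟩ := Fin.ext rfl
      rw [hee] at h1
      rw [hje]; simpa [h2] using h1
    · have h := (H (j - 1) (by omega)).2.2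
      have hje : j = ⟨(j : ℕ) - 1 + 1, by omega⟩ := Fin.ext (by simp; omega)
      rw [hje]; simpa using h

/-- **`δ(L₂ᵀ) ≤ 1`:** for an `L₂ᵀ` block space, `X ↦ X·B` in the block-footprint span forces `B₀₀ = B₁₁ = 0` and
`B₀₁ + B₁₀ = 0`, i.e. `B ∈ k·(E₀₁ − E₁₀)`. -/
theorem apply_eq_of_mem_deltaSpan_LT_two {B : Matrix (Fin 2) (Fin 2) k}
    (hB : (mulBilin k 2 2 2).flip B ∈ deltaSpan (LT 2 : KBlock k).space) :
    B 0 0 = 0 ∧ B 0 1 + B 1 0 = 0 ∧ B 1 1 = 0 := by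
  have h := dot_eq_zero_of_mem_deltaSpan (LT_pair_symm (k := k) 2 0 (by omega)) hB
  simp only [dotProduct_single, mul_one] at h
  exact h


/-! ### Square blocks with identity `A`-part (`N_u`) or identity `B`-part (companion blocks `C_c`), and `L_ε` -/

/-- For an `N_u` block the pair `(e_c, B-column c)` is symmetric on the generators. -/
theorem N_pair_symm (u : ℕ) (c : Fin u) :
    ∀ W ∈ (Set.range fun r : Fin (N u : KBlock k).rows => (N u : KBlock k).gen r),
      W 0 ⬝ᵥ (fun i : Fin u => (N u : KBlock k).B i c) = W 1 ⬝ᵥ (Pi.single c (1 : k)) := by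
  rintro W ⟨r, rfl⟩
  dsimp only
  rw [dotProduct_single, mul_one, gen_one_apply, dotProduct]
  simp only [gen_zero_apply, A]
  exact sum_ite_coe_eq (k := k) (m := u) r r.2 _

/-- **`δ(N_u) = 0`.** -/
theorem eq_zero_of_mem_deltaSpan_N (u : ℕ) {B : Matrix (Fin 2) (Fin u) k}
    (hB : (mulBilin k 2 2 u).flip B ∈ deltaSpan (N u : KBlock k).space) : B = 0 := by
  have H : ∀ c : Fin u, B 0 c = 0 ∧ B 0 ⬝ᵥ (fun i : Fin u => (N u : KBlock k).B i c) + B 1 c = 0 := by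
    intro c
    have h := dot_eq_zero_of_mem_deltaSpan (N_pair_symm (k := k) u c) hB
    simp only [dotProduct_single, mul_one] at h
    exact ⟨h.1, h.2.1⟩
  have h0 : ∀ c, B 0 c = 0 := fun c => (H c).1
  ext i j
  fin_cases i
  · exact h0 j
  · have h := (H j).2
    rw [dotProduct, Finset.sum_eq_zero (fun i _ => by rw [h0 i, zero_mul]), zero_add] at h
    exact h

/-- For a companion block `C_c` the pair `(A-column c', e_{c'})` is symmetric on the generators. -/
theorem C_pair_symm (c : List k) (c' : Fin c.length) :
    ∀ W ∈ (Set.range fun r : Fin (C c : KBlock k).rows => (C c : KBlock k).gen r),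
      W 0 ⬝ᵥ (Pi.single c' (1 : k)) = W 1 ⬝ᵥ (fun i : Fin c.length => (C c : KBlock k).A i c') := by
  rintro W ⟨r, rfl⟩
  dsimp only
  rw [dotProduct_single, mul_one, gen_zero_apply, dotProduct]
  simp only [gen_one_apply, B]
  exact (sum_ite_coe_eq (k := k) (m := c.length) r r.2 (fun i => (C c : KBlock k).A i c')).symm

/-- **`δ(C_c) = 0`** for every companion block (any coefficient list). -/
theorem eq_zero_of_mem_deltaSpan_C (c : List k) {B : Matrix (Fin 2) (Fin c.length) k}
    (hB : (mulBilin k 2 2 c.length).flip B ∈ deltaSpan (C c : KBlock k).space) : B = 0 := by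
  have H : ∀ c' : Fin c.length,
      B 0 c' + B 1 ⬝ᵥ (fun i : Fin c.length => (C c : KBlock k).A i c') = 0 ∧ B 1 c' = 0 := by
    intro c'
    have h := dot_eq_zero_of_mem_deltaSpan (C_pair_symm (k := k) c c') hB
    simp only [dotProduct_single, mul_one] at h
    exact ⟨h.2.1, h.2.2⟩
  have h1 : ∀ c', B 1 c' = 0 := fun c' => (H c').2
  ext i j
  fin_cases i
  · have h := (H j).1
    rw [dotProduct, Finset.sum_eq_zero (fun i _ => by rw [h1 i, zero_mul]), add_zero] at h
    exact h
  · exact h1 j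

/-- For an `L_ε` block the pair `(e_c, e_{c-1})` (second column `0` when `c = 0`) is symmetric on the generators. -/
theorem L_pair_symm (e : ℕ) (c : Fin (e + 1)) :
    ∀ W ∈ (Set.range fun r : Fin (L e : KBlock k).rows => (L e : KBlock k).gen r),
      W 0 ⬝ᵥ (fun i : Fin (e + 1) => if (i : ℕ) + 1 = c then (1 : k) else 0) = W 1 ⬝ᵥ (Pi.single c (1 : k)) := by
  rintro W ⟨r, rfl⟩
  dsimp only
  rw [dotProduct_single, mul_one, gen_one_apply, dotProduct]
  simp only [gen_zero_apply, A, B]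
  refine Eq.trans (sum_ite_coe_eq (k := k) (m := e + 1) r (by have := r.2; simp only [rows] at this; omega)
    (fun i : Fin (e + 1) => if (i : ℕ) + 1 = (c : ℕ) then (1 : k) else 0)) ?_
  by_cases h : (r : ℕ) + 1 = c
  · rw [if_pos h, if_pos h.symm]
  · rw [if_neg h, if_neg (fun h' => h h'.symm)]

/-- **`δ(L_ε) = 0`.** -/
theorem eq_zero_of_mem_deltaSpan_L (e : ℕ) {B : Matrix (Fin 2) (Fin (e + 1)) k}
    (hB : (mulBilin k 2 2 (e + 1)).flip B ∈ deltaSpan (L e : KBlock k).space) : B = 0 := by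
  have H : ∀ c : Fin (e + 1), B 0 c = 0 ∧
      B 0 ⬝ᵥ (fun i : Fin (e + 1) => if (i : ℕ) + 1 = c then (1 : k) else 0) + B 1 c = 0 := by
    intro c
    have h := dot_eq_zero_of_mem_deltaSpan (L_pair_symm (k := k) e c) hB
    simp only [dotProduct_single, mul_one] at h
    exact ⟨h.1, h.2.1⟩
  have h0 : ∀ c, B 0 c = 0 := fun c => (H c).1
  ext i j
  fin_cases i
  · exact h0 j
  · have h := (H j).2
    rw [dotProduct, Finset.sum_eq_zero (fun i _ => by rw [h0 i, zero_mul]), zero_add] at h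
    exact h

/-! ### The δ-table as `finrank` bounds in the shape of `two_mul_le_sum_delta_add` -/

/-- If every `B` with `X ↦ X·B` in `deltaSpan S` vanishes, then `range(B ↦ (X ↦ X·B)) ⊓ 𝒯 = ⊥` for every
`𝒯 ≤ deltaSpan S`. -/
theorem finrank_inf_eq_zero {m : ℕ} {S : Submodule k (Matrix (Fin 2) (Fin m) k)}
    (h0 : ∀ B : Matrix (Fin 2) (Fin m) k, (mulBilin k 2 2 m).flip B ∈ deltaSpan S → B = 0)
    {𝒯 : Submodule k (Matrix (Fin 2) (Fin 2) k →ₗ[k] Matrix (Fin 2) (Fin m) k)} (h𝒯 : 𝒯 ≤ deltaSpan S) :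
    finrank k ↥(LinearMap.range ((mulBilin k 2 2 m).flip) ⊓ 𝒯) = 0 := by
  have hbot : LinearMap.range ((mulBilin k 2 2 m).flip) ⊓ 𝒯 = ⊥ := by
    rw [Submodule.eq_bot_iff]
    rintro L ⟨⟨B, rfl⟩, hL⟩
    rw [h0 B (h𝒯 hL), map_zero]
  rw [hbot]
  exact finrank_bot k (Matrix (Fin 2) (Fin 2) k →ₗ[k] Matrix (Fin 2) (Fin m) k)

/-- Trivial bound: `range ⊓ 𝒯` sits inside `Hom`'s image of `k^{2×m}`, of dimension `2m`. -/
theorem finrank_inf_le_two_mul {m : ℕ} (𝒯 : Submodule k (Matrix (Fin 2) (Fin 2) k →ₗ[k] Matrix (Fin 2) (Fin m) k)) :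
    finrank k ↥(LinearMap.range ((mulBilin k 2 2 m).flip) ⊓ 𝒯) ≤ 2 * m := by
  calc finrank k ↥(LinearMap.range ((mulBilin k 2 2 m).flip) ⊓ 𝒯)
      ≤ finrank k ↥(LinearMap.range ((mulBilin k 2 2 m).flip)) := Submodule.finrank_mono inf_le_left
    _ ≤ finrank k (Matrix (Fin 2) (Fin m) k) := LinearMap.finrank_range_le _
    _ = 2 * m := by rw [finrank_matrix_fin]

/-- **`δ(L₂ᵀ) ≤ 1`** as a `finrank` bound. -/
theorem finrank_inf_le_one_LT_two
    {𝒯 : Submodule k (Matrix (Fin 2) (Fin 2) k →ₗ[k] Matrix (Fin 2) (Fin 2) k)}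
    (h𝒯 : 𝒯 ≤ deltaSpan (LT 2 : KBlock k).space) :
    finrank k ↥(LinearMap.range ((mulBilin k 2 2 2).flip) ⊓ 𝒯) ≤ 1 := by
  set J : Matrix (Fin 2) (Fin 2) k := single 0 1 1 - single 1 0 1 with hJ
  have hle : LinearMap.range ((mulBilin k 2 2 2).flip) ⊓ 𝒯 ≤ Submodule.span k {(mulBilin k 2 2 2).flip J} := by
    rintro L ⟨⟨B, rfl⟩, hL⟩
    obtain ⟨h00, h01, h11⟩ := apply_eq_of_mem_deltaSpan_LT_two (k := k) (h𝒯 hL)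
    have hB : B = B 0 1 • J := by
      ext i j
      fin_cases i <;> fin_cases j <;> simp [hJ, h00, h11]
      linear_combination h01
    rw [hB, map_smul]
    exact Submodule.smul_mem _ _ (Submodule.subset_span rfl)
  calc finrank k ↥(LinearMap.range ((mulBilin k 2 2 2).flip) ⊓ 𝒯)
      ≤ finrank k ↥(Submodule.span k {(mulBilin k 2 2 2).flip J}) := Submodule.finrank_mono hle
    _ ≤ 1 := by
        have h := finrank_span_le_card (R := k)
          ({(mulBilin k 2 2 2).flip J} : Set (Matrix (Fin 2) (Fin 2) k →ₗ[k] Matrix (Fin 2) (Fin 2) k))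
        simpa using h

/-- **The δ-TABLE (any field):** for every Kronecker block `blk` and every `𝒯` inside the block-footprint span of its
standard space, `dim (range(B ↦ (X ↦ X·B)) ⊓ 𝒯) ≤ δ(blk)` with `δ(L₁ᵀ) = 2`, `δ(L₂ᵀ) = 1` and `δ = 0` otherwise. -/
theorem finrank_inf_le_delta (blk : KBlock k)
    {𝒯 : Submodule k (Matrix (Fin 2) (Fin 2) k →ₗ[k] Matrix (Fin 2) (Fin blk.cols) k)}
    (h𝒯 : 𝒯 ≤ deltaSpan blk.space) :
    finrank k ↥(LinearMap.range ((mulBilin k 2 2 blk.cols).flip) ⊓ 𝒯) ≤ blk.delta := by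
  match blk, 𝒯, h𝒯 with
  | L e, 𝒯, h𝒯 =>
      exact (finrank_inf_eq_zero (fun B hB => eq_zero_of_mem_deltaSpan_L (k := k) e hB) h𝒯).le.trans
        (Nat.zero_le _)
  | N u, 𝒯, h𝒯 =>
      exact (finrank_inf_eq_zero (fun B hB => eq_zero_of_mem_deltaSpan_N (k := k) u hB) h𝒯).le.trans
        (Nat.zero_le _)
  | C c, 𝒯, h𝒯 =>
      exact (finrank_inf_eq_zero (fun B hB => eq_zero_of_mem_deltaSpan_C (k := k) c hB) h𝒯).le.trans
        (Nat.zero_le _)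
  | LT 0, 𝒯, h𝒯 => exact (finrank_inf_le_two_mul 𝒯).trans (by simp [cols, delta])
  | LT 1, 𝒯, h𝒯 => exact (finrank_inf_le_two_mul 𝒯).trans (by simp [cols, delta])
  | LT 2, 𝒯, h𝒯 => exact (finrank_inf_le_one_LT_two h𝒯).trans (by simp [delta])
  | LT (e + 3), 𝒯, h𝒯 =>
      exact (finrank_inf_eq_zero
        (fun B hB => eq_zero_of_mem_deltaSpan_LT (k := k) (e + 3) (by omega) hB) h𝒯).le.trans (Nat.zero_le _)

/-! ### `L_ε` blocks do not occur: the top-right entry of every block footprint vanishes -/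

/-- The entry functional `W ↦ W i j`. -/
def entryLM {m : ℕ} (i : Fin 2) (j : Fin m) : Matrix (Fin 2) (Fin m) k →ₗ[k] k where
  toFun W := W i j
  map_add' _ _ := rfl
  map_smul' _ _ := rfl

/-- `entryLM i j W = W i j`. -/
@[simp] theorem entryLM_apply {m : ℕ} (i : Fin 2) (j : Fin m) (W : Matrix (Fin 2) (Fin m) k) :
    entryLM i j W = W i j := rfl

/-- The last column index `ε` of an `L_ε` block (which has `ε + 1` columns). -/
def lastL (e : ℕ) : Fin (L e : KBlock k).cols := ⟨e, lt_add_one e⟩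

/-- Column `0` of an `L_ε` block. -/
def zeroL (e : ℕ) : Fin (L e : KBlock k).cols := ⟨0, Nat.succ_pos e⟩

/-- Column `c + 1` of an `L_ε` block (`c < ε`). -/
def succL (e c : ℕ) (hc : c < e) : Fin (L e : KBlock k).cols := ⟨c + 1, Nat.succ_lt_succ hc⟩

/-- Column `c` of an `L_ε` block (`c < ε`). -/
def castL (e c : ℕ) (hc : c < e) : Fin (L e : KBlock k).cols := ⟨c, Nat.lt_succ_of_lt hc⟩

omit [Field k] in
/-- Value of `lastL`. -/
@[simp] theorem val_lastL (e : ℕ) : ((lastL (k := k) e : Fin _) : ℕ) = e := rfl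
omit [Field k] in
/-- Value of `zeroL`. -/
@[simp] theorem val_zeroL (e : ℕ) : ((zeroL (k := k) e : Fin _) : ℕ) = 0 := rfl
omit [Field k] in
/-- Value of `succL`. -/
@[simp] theorem val_succL (e c : ℕ) (hc : c < e) : ((succL (k := k) e c hc : Fin _) : ℕ) = c + 1 := rfl
omit [Field k] in
/-- Value of `castL`. -/
@[simp] theorem val_castL (e c : ℕ) (hc : c < e) : ((castL (k := k) e c hc : Fin _) : ℕ) = c := rfl

/-- Coordinates of the `L_ε` block space: the top row vanishes in the last column. -/
theorem L_space_top_last (e : ℕ) {W : Matrix (Fin 2) (Fin (L e : KBlock k).cols) k}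
    (hW : W ∈ (L e : KBlock k).space) : W 0 (lastL e) = 0 := by
  have hle : (L e : KBlock k).space ≤ LinearMap.ker (entryLM (k := k) 0 (lastL (k := k) e)) := by
    refine Submodule.span_le.mpr ?_
    rintro W ⟨r, rfl⟩
    have hr := r.2
    simp only [rows] at hr
    change entryLM (k := k) 0 (lastL (k := k) e) ((L e : KBlock k).gen r) = 0
    rw [entryLM_apply, gen_zero_apply]
    simp only [A, val_lastL]
    rw [if_neg]
    omega
  exact hle hW

/-- … the bottom row vanishes in column `0`. -/
theorem L_space_bot_zero (e : ℕ) {W : Matrix (Fin 2) (Fin (L e : KBlock k).cols) k}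
    (hW : W ∈ (L e : KBlock k).space) : W 1 (zeroL e) = 0 := by
  have hle : (L e : KBlock k).space ≤ LinearMap.ker (entryLM (k := k) 1 (zeroL (k := k) e)) := by
    refine Submodule.span_le.mpr ?_
    rintro W ⟨r, rfl⟩
    change entryLM (k := k) 1 (zeroL (k := k) e) ((L e : KBlock k).gen r) = 0
    rw [entryLM_apply, gen_one_apply]
    simp [B, val_zeroL]
  exact hle hW

/-- … and the bottom row is the top row shifted by one column. -/
theorem L_space_shift (e : ℕ) {W : Matrix (Fin 2) (Fin (L e : KBlock k).cols) k}
    (hW : W ∈ (L e : KBlock k).space) (c : ℕ) (hc : c < e) : W 1 (succL e c hc) = W 0 (castL e c hc) := by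
  have hle : (L e : KBlock k).space ≤
      LinearMap.ker (entryLM (k := k) 1 (succL (k := k) e c hc) - entryLM (k := k) 0 (castL (k := k) e c hc)) := by
    refine Submodule.span_le.mpr ?_
    rintro W ⟨r, rfl⟩
    change (entryLM (k := k) 1 (succL (k := k) e c hc) - entryLM (k := k) 0 (castL (k := k) e c hc))
      ((L e : KBlock k).gen r) = 0
    rw [LinearMap.sub_apply, entryLM_apply, entryLM_apply, gen_one_apply, gen_zero_apply]
    simp only [A, B, val_succL, val_castL]
    by_cases h : c = (r : ℕ)
    · rw [if_pos (by omega), if_pos h, sub_self]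
    · rw [if_neg (by omega), if_neg h, sub_self]
  have h : (entryLM (k := k) 1 (succL (k := k) e c hc) - entryLM (k := k) 0 (castL (k := k) e c hc)) W = 0 :=
    hle hW
  rw [LinearMap.sub_apply, entryLM_apply, entryLM_apply, sub_eq_zero] at h
  exact h

/-- **Top-right lemma for `L_ε`.** If `X·B − (f(X)/f(1))·B` lies in the `L_ε` block space for every `X` (a block
footprint in `L_ε` position), then the top-right entry of `B` vanishes (test `X = E₁₀`). Since at a saturated point the
block footprints of the off outputs span all of `k^{2×(ε+1)}`, no `L_ε` block occurs (`InvertiblePointDeltaLaw`). -/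
theorem L_topRight_eq_zero (e : ℕ) {f : Module.Dual k (Matrix (Fin 2) (Fin 2) k)} (hf : f 1 ≠ 0)
    {B : Matrix (Fin 2) (Fin (L e : KBlock k).cols) k}
    (hB : ∀ X : Matrix (Fin 2) (Fin 2) k, X * B - (f X * (f 1)⁻¹) • B ∈ (L e : KBlock k).space) :
    B 0 (lastL e) = 0 := by
  have h1 := L_space_top_last (k := k) e (hB (single 1 0 1))
  rw [Matrix.sub_apply, Matrix.smul_apply, smul_eq_mul, single_one_mul_apply] at h1
  simp only [Fin.isValue, zero_ne_one, ↓reduceIte, zero_sub, neg_eq_zero, mul_eq_zero] at h1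
  rcases h1 with (h | h) | h
  · -- `f(E₁₀) = 0`: then the top row of `B` vanishes identically
    rcases Nat.eq_zero_or_pos e with he | he
    · subst he
      have h2 := L_space_bot_zero (k := k) 0 (hB (single 1 0 1))
      rw [Matrix.sub_apply, Matrix.smul_apply, smul_eq_mul, single_one_mul_apply, h, zero_mul, zero_mul,
        sub_zero] at h2
      have hidx : zeroL (k := k) 0 = lastL 0 := Fin.ext rfl
      rw [hidx] at h2
      simpa using h2
    · have h3 := L_space_shift (k := k) e (hB (single 1 0 1)) (e - 1) (by omega)
      rw [Matrix.sub_apply, Matrix.smul_apply, smul_eq_mul, single_one_mul_apply, Matrix.sub_apply,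
        Matrix.smul_apply, smul_eq_mul, single_one_mul_apply, h, zero_mul, zero_mul, sub_zero, zero_mul,
        sub_zero] at h3
      simp only [Fin.isValue, ↓reduceIte] at h3
      have hidx : succL (k := k) e (e - 1) (by omega) = lastL e := Fin.ext (by simp; omega)
      rw [hidx] at h3
      exact h3
  · exact absurd h (inv_ne_zero hf)
  · exact h

end Kronecker.KBlock

end Summit.MatrixMultiplication.OmegaCensus.SmallFormats
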